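import Summits.AtomisticToContinuum.Crystallization.Theses.PhononSlackCertificates
import Summits.AtomisticToContinuum.Crystallization.Theorems.PhononSlackCertificatesFarFieldGapRHole
import Summits.AtomisticToContinuum.Crystallization.Theorems.PhononSlackCertificatesFarFieldGapRTail
import Summits.AtomisticToContinuum.Crystallization.Theorems.PhononSlackCertificatesFarFieldGapRLocal
import Summits.AtomisticToContinuum.Crystallization.Theorems.PhononSlackCertificatesFarFieldGapRDecomp
import Summits.AtomisticToContinuum.Crystallization.Theorems.PhononSlackCertificatesFarFieldGapRIter
import Summits.AtomisticToContinuum.Crystallization.Theorems.PhononSlackCertificatesFarFieldGapRStep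
import Summits.AtomisticToContinuum.Crystallization.Theorems.PhononSlackCertificatesFarFieldGapRGlue
import Summits.AtomisticToContinuum.Crystallization.Theorems.PhononSlackCertificatesAllBadGap

/-!
# Route `PhononSlackCertificates`, crux `FarFieldGapR` (stmt-AtomisticToContinuum-14969):
the octahedral-poisoning collapse `AllBadGap → FarFieldGapR` (line `Sketch`), composed

The seven registered stubs of the line `Sketch` have all landed as `--supports` files in this
namespace (`stub_hole`, `stub_tail`, `stub_local`, `stub_decomp`, `stub_iter`, `stub_step`,
`stub_glue`, files `PhononSlackCertificatesFarFieldGapR{Hole,Tail,Local,Decomp,Iter,Step,Glue}`).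
This file is the COMPOSITION of the registered skeleton
(`Cruxes/FarFieldGapR/Lines/Sketch.lean`), now sorry-free:

* `FarFieldGapR_of : AllBadGap → FarFieldGapR` — the rank-2 crux follows from its own special
  case `U = everything`, the support item `AllBadGap` (stmt-AtomisticToContinuum-13960): poison
  every good particle of the sub-configuration `x|_U` at its octahedral hole (`stub_step`,
  iterated by `stub_iter`), apply `AllBadGap` to the all-bad result, and book-keep the cross terms
  with the decaying shell sum (`stub_glue` with `stub_tail`, `stub_local`, `stub_decomp`).
* `farFieldGapR_iff_allBadGap : FarFieldGapR ↔ AllBadGap` — with the converse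
  `PhononSlackCertificatesAllBadGap.allBadGap_of_farFieldGapR` (landed by the refuter) the crux is
  now LITERALLY EQUIVALENT to the all-bad bulk gap; what remains open is exactly stmt-13960.
* `farFieldGapR_of_coerciveTwoShellGap : CoerciveTwoShellGap → FarFieldGapR` — in particular the
  crux follows from the route's target (stmt-13956), through `allBadGap_of_coerciveTwoShellGap`.

All three are CONDITIONAL (hypotheses are open route items, not Literature facts); nothing here
is vendored, every decl is used toward the crux.
-/

noncomputable section

namespace Summit.AtomisticToContinuum.Crystallization.Theorems.PhononSlackCertificatesFarFieldGapR

open Summit.AtomisticToContinuum.Crystallization.Theses.PhononSlackCertificates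
  (AllBadGap FarFieldGapR CoerciveTwoShellGap)

/-- **THE COLLAPSE `AllBadGap → FarFieldGapR`** (line `Sketch`, composition of the seven landed
stubs, verbatim the registered skeleton's `FarFieldGapR_of`): the rank-2 crux follows from its own
special case `U = everything` (support item stmt-AtomisticToContinuum-13960).  `stub_glue`
concludes the verbatim body of the route decl; this theorem restates it BY NAME; the poisoning
step (`stub_step`, fed the octahedral-hole facts `stub_hole`) and its iteration (`stub_iter`) are
composed into the poisoning of everything inline.  CONDITIONAL on `AllBadGap` (open). -/
theorem FarFieldGapR_of (hA : AllBadGap) : FarFieldGapR :=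
  stub_glue hA
    (fun δ hδ hδ' => by
      obtain ⟨K, hK, hstep⟩ := stub_step stub_hole δ hδ hδ'
      exact ⟨K, hK, stub_iter δ K hK hstep⟩)
    stub_tail stub_local stub_decomp

/-- **The crux is the all-bad bulk gap**: `FarFieldGapR ↔ AllBadGap` — the converse is the
`∂U = ∅` instance `PhononSlackCertificatesAllBadGap.allBadGap_of_farFieldGapR`, the direct
implication is the collapse `FarFieldGapR_of`.  Unconditional equivalence of two open route items
(stmt-AtomisticToContinuum-14969 and stmt-AtomisticToContinuum-13960). -/
theorem farFieldGapR_iff_allBadGap : FarFieldGapR ↔ AllBadGap :=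
  ⟨PhononSlackCertificatesAllBadGap.allBadGap_of_farFieldGapR, FarFieldGapR_of⟩

/-- **`CoerciveTwoShellGap → FarFieldGapR`**: the crux follows from the route's target
(stmt-AtomisticToContinuum-13956) through `allBadGap_of_coerciveTwoShellGap` and the collapse
(read off the equivalence `farFieldGapR_iff_allBadGap`).  CONDITIONAL on `CoerciveTwoShellGap`
(open). -/
theorem farFieldGapR_of_coerciveTwoShellGap (h : CoerciveTwoShellGap) : FarFieldGapR :=
  farFieldGapR_iff_allBadGap.2 (PhononSlackCertificatesAllBadGap.allBadGap_of_coerciveTwoShellGap h)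

end Summit.AtomisticToContinuum.Crystallization.Theorems.PhononSlackCertificatesFarFieldGapR

end
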